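/-
Copyright: the b2b-balaban cell (near-miss cell 7), T⁴-continuum CRUX team (coordinator ruling e34b3e0c item (2)),
seat t4-ne7b-formalise-leaf-06 (gen 28). Released under the licence of the surrounding project.
-/
import Mathlib.Analysis.SpecialFunctions.Pow.Real
import HarnessLib

/-!
# PH-k (δ): the bootstrap gap of the envelope iteration `B ↦ 1 + κ·B²` — kernel certificate of PRICING-NE7b v5 F23a
# (route NE7b R-H, `t4/ROUTES-NE7b.md` v5 §2 PH-k (δ); `b2b-balaban-t4-ne7b-refuter/PRICING-NE7b.md` v5 F23a∕F23c PH-k″)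

Cell `pub-balaban`, sub-cell `t4`, spine estimate NE7b (node U5c), candidate route R-H, lemma PH-k. ROUTES-NE7b v5 (δ)
iterates the barrier (γ) with an improving a-priori envelope: «`B_{i+1} = 1 + κ·max(B_i, 2)²`, `κ := C_d R_c² ε_k`,
converges to `C_reg = (1 + 4κ)·(1 + tails)`», with the terminal clause «`4C_d R_c² ε_k ≤ Λ ≈ 166`». The refuter's
PRICING-NE7b v5 **F23a** locates a slip: «the iteration has NO fixed point `≤ 2` unless `κ_C ≤ ¼` (smaller root
`B* = (1 − √(1 − 4κ_C))∕2κ_C ∈ [1, 2]`); for `κ_C > ¼` the map runs away from any finite start … Correct terminal clause: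
`κ_C ≤ ¼` (`C_reg ≤ 2`)», and F23c (PH-k″) uses «the bootstrap GAP (`B ≤ 2 ⇒ B ≤ 1 + 4κ_C < 2` when `κ_C < ¼`)».

THIS FILE certifies that elementary real algebra in the kernel (it is the arithmetic behind the (S-Kfin′) amendment the
dagwriter books; nothing else):
* `no_fixedPoint_of_quarter_lt` — for `κ > ¼` and every real `B`: `B < 1 + κB²` (no fixed point, no sub-solution at all);
* **`bootstrap_gap`** — for `κ ≥ 0`: `B ≤ 2` and `B ≤ 1 + κB²` imply `B ≤ 1 + 4κ` (the GAP: an envelope that is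
  a-priori `≤ 2` and reproduces itself through (γ) is in fact `≤ 1 + 4κ`; informative exactly when `κ ≤ ¼`);
* `bootstrap_gap_sharp` — under the same hypotheses `B ≤ 2∕(1 + √(1 − 4κ))` (`= B*`, the smaller root);
* `fixedPoint_smallRoot` — `B* = 1 + κ·B*²`, `1 ≤ B* ≤ 1 + 4κ`; `iterate_le_smallRoot` — `0 ≤ B ≤ B* ⇒ 1 + κB² ≤ B*`
  (the iteration from `B₀ = 1` increases to `B*` and never passes it).

HONEST FRAMING. Pure real algebra; `κ` here is the route's `κ_C = C_d·m²·D²`-type parameter, whose SIZE in Bałaban's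
window (F23: thresholds in `ℓ`) is calc's∕the refuter's arithmetic on the cell's grammar and is NOT touched here; nothing
of (MP<L²), of the envelope's existence, or of [Bałaban 1983–89] is asserted or cited. NE7b (`T4WeightBudget.RelWeightBound`)
NOT PRINTED, NOT PROVED; spine PROVED 0∕9; rung (B)+1 on a FINITE torus T⁴ — NOT infinite volume, NOT the mass gap, NOT
Clay. HONEST DEPENDENCY: continuum YM on T⁴ ⇐ BetaPertH ∧ nine spine estimates (0/9 proved); BetaPertH ⇐ (D1) ∧ (D4) ∧
CAP+tail; G-an2-4 gates asym, D1 and NE2/3/4. POLICY: crux-route work under `Spine/NE7b/` (FREEZE (0) respected: a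
kernel certificate of a located PRICING item, not a `T4Continuum/Support` leaf, not a folklore-algebra module);
0 definitions, no `Prop` fact, no `[cite:]` fact.
-/

set_option autoImplicit false

namespace Summit.QuantumFields.BalabanUV.T4Continuum.NE7b.BootstrapGap

/-- **NO FIXED POINT ABOVE THE QUARTER** (F23a): for `κ > ¼` the map `B ↦ 1 + κB²` lies strictly above the diagonal —
no real `B` satisfies `B = 1 + κB²`, nor even `1 + κB² ≤ B` (discriminant `1 − 4κ < 0`). -/
theorem no_fixedPoint_of_quarter_lt {κ : ℝ} (hκ : 1 / 4 < κ) (B : ℝ) : B < 1 + κ * B ^ 2 := by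
  nlinarith [sq_nonneg (2 * κ * B - 1), sq_nonneg B]

/-- **THE BOOTSTRAP GAP** (F23a ∕ F23c PH-k″): for `κ ≥ 0`, an envelope constant `B ≤ 2` which reproduces itself
through the barrier step, `B ≤ 1 + κB²`, is in fact `≤ 1 + 4κ`. (For `κ ≤ ¼`: the quadratic `κB² − B + 1` is `≤ 0` at
`B = 1 + 4κ` and at `B = 2`, hence, by convexity, `< 0` strictly between; for `κ > ¼` the conclusion is weaker than
`B ≤ 2` — the content is F23a's regime `κ ≤ ¼`, where `1 + 4κ ≤ 2`.) -/
theorem bootstrap_gap {κ B : ℝ} (hκ : 0 ≤ κ) (hB2 : B ≤ 2) (hB : B ≤ 1 + κ * B ^ 2) :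
    B ≤ 1 + 4 * κ := by
  by_contra h
  rw [not_le] at h
  -- on `(1 + 4κ, 2]` the convex quadratic `κB² − B + 1` is negative
  have h1 : 0 < B - (1 + 4 * κ) := by linarith
  have h2 : 0 ≤ 2 - B := by linarith
  nlinarith [mul_nonneg h1.le h2, mul_nonneg hκ h2, mul_nonneg hκ h1.le, sq_nonneg (B - 2), mul_pos h1 h1]

/-- **THE FIXED POINT** (F23a's `B*`): for `0 ≤ κ ≤ ¼`, `B* := 2∕(1 + √(1 − 4κ))` satisfies `B* = 1 + κ·B*²` and
`1 ≤ B* ≤ 1 + 4κ` (so `B* ≤ 2`). -/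
theorem fixedPoint_smallRoot {κ : ℝ} (hκ : 0 ≤ κ) (hκ4 : κ ≤ 1 / 4) :
    2 / (1 + Real.sqrt (1 - 4 * κ)) = 1 + κ * (2 / (1 + Real.sqrt (1 - 4 * κ))) ^ 2 ∧
      1 ≤ 2 / (1 + Real.sqrt (1 - 4 * κ)) ∧ 2 / (1 + Real.sqrt (1 - 4 * κ)) ≤ 1 + 4 * κ := by
  set r := Real.sqrt (1 - 4 * κ) with hr
  have hr0 : 0 ≤ r := Real.sqrt_nonneg _
  have hr2 : r ^ 2 = 1 - 4 * κ := by rw [hr, Real.sq_sqrt (by linarith)]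
  have hr1 : r ≤ 1 := by nlinarith
  have hpos : 0 < 1 + r := by linarith
  refine ⟨?_, ?_, ?_⟩
  · have e1 : κ * (2 / (1 + r)) ^ 2 = (1 - r) / (1 + r) := by
      rw [div_pow, mul_div_assoc', show κ * 2 ^ 2 = (1 - r) * (1 + r) by ring_nf; linarith [hr2], pow_two,
        mul_div_mul_right _ _ hpos.ne']
    rw [e1]
    field_simp
    ring
  · rw [le_div_iff₀ hpos]; linarith
  · rw [div_le_iff₀ hpos]; nlinarith [hr2, mul_nonneg hκ hr0]

/-- **THE SHARP GAP**: for `0 ≤ κ ≤ ¼`, `B ≤ 2` and `B ≤ 1 + κB²` imply `B ≤ B* = 2∕(1 + √(1 − 4κ))` (the larger root is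
`≥ 2`, so a self-reproducing envelope `≤ 2` sits below the smaller root). -/
theorem bootstrap_gap_sharp {κ B : ℝ} (hκ : 0 ≤ κ) (hκ4 : κ ≤ 1 / 4) (hB2 : B ≤ 2) (hB : B ≤ 1 + κ * B ^ 2) :
    B ≤ 2 / (1 + Real.sqrt (1 - 4 * κ)) := by
  set r := Real.sqrt (1 - 4 * κ) with hr
  have hr0 : 0 ≤ r := Real.sqrt_nonneg _
  have hr2 : r ^ 2 = 1 - 4 * κ := by rw [hr, Real.sq_sqrt (by linarith)]
  have hr1 : r ≤ 1 := by nlinarith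
  have hpos : 0 < 1 + r := by linarith
  rw [le_div_iff₀ hpos]
  -- `κB² − B + 1 ≥ 0` factors as `κ (B − B₋)(B − B₊)` with `2κB_± = 1 ± r`; `B ≤ 2 ≤ B₊` forces `B ≤ B₋`.
  by_contra h
  rw [not_le] at h
  -- from `B(1+r) > 2`: `2κB > 1 - r`, i.e. `B` is above the smaller root; and `2κB ≤ 4κ ≤ 1 + r` puts it below the larger
  have h4 : 4 * κ = (1 - r) * (1 + r) := by nlinarith [hr2]
  nlinarith [mul_nonneg hκ (sub_nonneg.2 hB2), sq_nonneg (2 * κ * B - 1), hr2, h, hκ, hr0, hr1,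
    mul_nonneg (mul_nonneg hκ hr0) (sub_nonneg.2 hB2)]

/-- **MONOTONE ITERATION BELOW THE FIXED POINT**: for `0 ≤ κ ≤ ¼` and `0 ≤ B ≤ B*`, one barrier step keeps the
envelope below `B*`: `1 + κB² ≤ B*`. Hence the iteration `B₀ = 1, B_{i+1} = 1 + κB_i²` is increasing and bounded by
`B* ≤ 1 + 4κ` — ROUTES v5 (δ)'s «converges to `1 + 4κ`», valid exactly in F23a's regime `κ ≤ ¼`. -/
theorem iterate_le_smallRoot {κ B : ℝ} (hκ : 0 ≤ κ) (hκ4 : κ ≤ 1 / 4) (hB0 : 0 ≤ B)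
    (hB : B ≤ 2 / (1 + Real.sqrt (1 - 4 * κ))) :
    1 + κ * B ^ 2 ≤ 2 / (1 + Real.sqrt (1 - 4 * κ)) := by
  obtain ⟨hfix, h1, _⟩ := fixedPoint_smallRoot hκ hκ4
  calc 1 + κ * B ^ 2 ≤ 1 + κ * (2 / (1 + Real.sqrt (1 - 4 * κ))) ^ 2 := by
        gcongr
    _ = 2 / (1 + Real.sqrt (1 - 4 * κ)) := hfix.symm

end Summit.QuantumFields.BalabanUV.T4Continuum.NE7b.BootstrapGap
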